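import Summits.CriticalPhenomena.PercolationContinuityZ3.Theorems.Transplant.FKConnectivityAllQSPDefs
import HarnessLib

/-!
# Connectivity correlation inequalities for `φ_{w,q}` — file 71d (DEFINITION): two-terminal series–parallel networks whose set of
# special edges first separates at a PARALLEL node

Definitions file (`--supports stmt-CriticalPhenomena-4575`), FK sub-lane `prim-bschramm-fk-2` (gen 31) of the post-continuity
programme; builds on p205010 (kernel theorem, internal audit signed; external expert review pending).  No theorems, no named
facts, no sorries.  Memo FROM-fk-2-g31-DUALITY.md §4 (O).

The root-form calculus for the `q`-free antipodal inequality (`FK.RootForm.*`, files 61–64) carries five facts along the series–parallel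
decomposition of the environment `𝓔` of a host `x ∥ 𝓔`; for three special edges the one junction whose facts are not all supplied by
theorems in the tree is a SERIES node at which the specials first separate (memo §1).  Under two-terminal duality (file 71b) that node
becomes parallel.  This file names the good class: `FK.IsParSplit E a b S` says that the edge set `E` is a two-terminal series–parallel
network between `a` and `b` obtained from a PARALLEL composition `E₁ ∥ E₂` both of whose parts meet the finite set `S` (of special
edges) by further series / parallel compositions with parts DISJOINT from `S` — i.e. `E` has a binary series–parallel decomposition in
which the first node separating `S` is a parallel node.  The constructors and side conditions are literally those of `FK.IsTTSP`
(file 9); `IsParSplit E a b S → IsTTSP E a b` and the orientation lemma "`IsParSplit` for `E` or for its dual" are in the sibling proof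
files.  (Pattern: Duffin 1965, Thm. 1; not used and not claimed in Lean.)
[cite: Grimmett2006, §3.9 (pp. 63–64)] [folklore: Duffin 1965, §4]
-/

namespace Summit.CriticalPhenomena.PercolationContinuityZ3.Theorems

namespace FK

open scoped Classical

variable {V : Type*}

/-- **Parallel first split** `IsParSplit E a b S`: `E` is a two-terminal series–parallel network between `a` and `b` built from a
parallel composition of two networks BOTH meeting `S` (`base`), by series / parallel compositions with networks disjoint from `S`
(the four attachment constructors; side conditions verbatim those of `FK.IsTTSP`).  For `2 ≤ |S ∩ E|`-type uses: the first node of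
the decomposition separating the special edges `S` is a parallel node. [folklore] -/
inductive IsParSplit : Finset (Sym2 V) → V → V → Finset (Sym2 V) → Prop
  /-- the parallel split itself: both parts meet `S` -/
  | base {E₁ E₂ : Finset (Sym2 V)} {s t : V} {S : Finset (Sym2 V)} (h₁ : IsTTSP E₁ s t) (h₂ : IsTTSP E₂ s t)
      (hd : Disjoint E₁ E₂) (hV : ∀ z : V, (∃ e ∈ E₁, z ∈ e) → (∃ e ∈ E₂, z ∈ e) → z = s ∨ z = t)
      (hS₁ : (S ∩ E₁).Nonempty) (hS₂ : (S ∩ E₂).Nonempty) : IsParSplit (E₁ ∪ E₂) s t S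
  /-- series attachment of an `S`-free network on the right -/
  | series_left {E₁ E₂ : Finset (Sym2 V)} {a m b : V} {S : Finset (Sym2 V)} (h₁ : IsParSplit E₁ a m S) (h₂ : IsTTSP E₂ m b)
      (hd : Disjoint E₁ E₂) (hV : ∀ z : V, (∃ e ∈ E₁, z ∈ e) → (∃ e ∈ E₂, z ∈ e) → z = m)
      (ha : ∀ e ∈ E₂, a ∉ e) (hb : ∀ e ∈ E₁, b ∉ e) (hS : Disjoint S E₂) : IsParSplit (E₁ ∪ E₂) a b S
  /-- series attachment of an `S`-free network on the left -/
  | series_right {E₁ E₂ : Finset (Sym2 V)} {a m b : V} {S : Finset (Sym2 V)} (h₁ : IsTTSP E₁ a m) (h₂ : IsParSplit E₂ m b S)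
      (hd : Disjoint E₁ E₂) (hV : ∀ z : V, (∃ e ∈ E₁, z ∈ e) → (∃ e ∈ E₂, z ∈ e) → z = m)
      (ha : ∀ e ∈ E₂, a ∉ e) (hb : ∀ e ∈ E₁, b ∉ e) (hS : Disjoint S E₁) : IsParSplit (E₁ ∪ E₂) a b S
  /-- parallel attachment of an `S`-free network (second part) -/
  | parallel_left {E₁ E₂ : Finset (Sym2 V)} {s t : V} {S : Finset (Sym2 V)} (h₁ : IsParSplit E₁ s t S) (h₂ : IsTTSP E₂ s t)
      (hd : Disjoint E₁ E₂) (hV : ∀ z : V, (∃ e ∈ E₁, z ∈ e) → (∃ e ∈ E₂, z ∈ e) → z = s ∨ z = t) (hS : Disjoint S E₂) :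
      IsParSplit (E₁ ∪ E₂) s t S
  /-- parallel attachment of an `S`-free network (first part) -/
  | parallel_right {E₁ E₂ : Finset (Sym2 V)} {s t : V} {S : Finset (Sym2 V)} (h₁ : IsTTSP E₁ s t) (h₂ : IsParSplit E₂ s t S)
      (hd : Disjoint E₁ E₂) (hV : ∀ z : V, (∃ e ∈ E₁, z ∈ e) → (∃ e ∈ E₂, z ∈ e) → z = s ∨ z = t) (hS : Disjoint S E₁) :
      IsParSplit (E₁ ∪ E₂) s t S

end FK

end Summit.CriticalPhenomena.PercolationContinuityZ3.Theorems
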